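import Literature.AlgebraicGeometry.Resolution.AlterationsSemiStable
import Literature.AlgebraicGeometry.Resolution.AlterationsSemiStableResolution
import Literature.AlgebraicGeometry.Resolution.QuasiSplitNormalFormPair
import Literature.AlgebraicGeometry.Resolution.BlowupsEquivariant
import Summits.ResolutionOfSingularities.ResolutionOfSingularities.Theorems.WildQuotientsSummitReductionStubPairSsOrbitBlowupLemmas
import Summits.ResolutionOfSingularities.ResolutionOfSingularities.Theorems.WildQuotientsSummitReductionStubPairSsOrbitBlowup7Lemmas
import Mathlib.AlgebraicGeometry.Geometrically.Irreducible
import HarnessLib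

/-!
# `WildQuotients.SummitReduction` (stmt-ResolutionOfSingularities-16324), line `FramePerfect`, stub
# `stub_pair_ssOrbitBlowup` (B): the stub over a PERFECT field from its two next-layer statements

Route `ResolutionOfSingularities/WildQuotients`, crux `SummitReduction`; helper file of the line
skeleton `Cruxes/SummitReduction/Lines/FramePerfect.lean` (v7), stub B (`stub_pair_ssOrbitBlowup` =
de Jong 1997, Prop. 5.11 ¶2–3 = de Jong 1996, 3.5 + 4.25–4.28 made `G`-equivariant).

With the invariant of the orbit blow-up iteration now DEFINED in the tree
(`DeJong1997.QuasiSplitNormalFormPair`, `Literature/…/QuasiSplitNormalFormPair.lean`: de Jong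
1997's coefficient-free, equivariant Situation 4.25), the LANDED iteration
(`ssOrbitBlowup_of_invariant`) and the LANDED formal/étale comparison of normal crossings over a
perfect field (`isNormalCrossingsDivisor_of_isSNCIdeal_completedStalkIdeal`), stub B reduces to
exactly two next-layer statements, both about `QuasiSplitNormalFormPair` and both generalisations
of theorems the tree has over an algebraically closed field for one component at a time:

* (N) **the entry** = de Jong 1996, 3.5 with 4.24 for QUASI-SPLIT `G`-semi-stable pairs with
  `codim(Sing X, X) ≥ 3` over a perfect field (de Jong 1997, 5.11 ¶2: "The types of complete local
  rings that we have now are `A⟦u,v⟧/(uv - t₁ ⋯ t_s)` … Any `G`-orbit of a component of the singular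
  locus of `X` is nonsingular"): the pair `(X, ⋃ᵢ τᵢ(Y) ∪ f⁻¹ D)` with the action `ρX` is a
  `QuasiSplitNormalFormPair` of dimension `dim X` — the tree's `DeJong1996SemiStablePairIsNormalForm_holds`
  generalised (2.23 at quasi-split points is in the tree: `NodalDeformation.exists_ringEquiv_cpl`,
  `exists_fittingIdeal_eq_span_pair_of_quasiSplit`);
* (S) **the orbit version of Claim 4.27** (de Jong 1997, 5.11 ¶3: "Thus we blow up in orbits of
  components of the singular locus of `X`. The resulting scheme has a local description as above by
  the computations of [1, 4.27]"): an equivariant projective blow-up of a `QuasiSplitNormalFormPair`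
  in the reduced orbit closure of a component of `Sing X` is again a `QuasiSplitNormalFormPair`, for
  the lifted action and the preimage boundary, with FEWER singular components — the tree's
  `DeJong1996NormalFormPairBlowup_holds` generalised (arbitrary residue fields at the closed points,
  a disjoint union of regular components as centre).

Proved here (sorry-free):
* `quasiSplitNormalFormPair_hzero` — the obligation `hzero` of the iteration for this invariant over
  a perfect field: no singular component ⇒ `X` regular (`isRegular_of_irreducibleComponents_eq_empty`)
  and `Z` a normal crossings divisor (the landed comparison, fed by field 4.25 (i));
* `quasiSplitNormalFormPair_orbitCentre` — the centre bookkeeping of `hstep`: the reduced ideal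
  sheaf of the orbit closure of a singular component is a non-zero `ρ`-stable ideal sheaf;
* `ssOrbitBlowup_of_quasiSplitNormalFormPair` — given (S), the conclusion of stub B for every
  `G`-scheme over a perfect field whose pair is a `QuasiSplitNormalFormPair`, by
  `ssOrbitBlowup_of_invariant` with `P X p ρ Z n := QuasiSplitNormalFormPair p Z ρ d ∧
  #components(Sing X) = n` (registered sub-goal of the stub);
* `stub_pair_ssOrbitBlowup_of_normalForm_of_orbitClaim` — **stub B with `[PerfectField k]`** (the
  line's induction `pair_statementUpToDim` runs over a perfect field, so the binder is free for the
  skeleton) from (N) and (S).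

## Sources

* A. J. de Jong, *Families of curves and alterations*, Ann. Inst. Fourier 47 (1997), Prop. 5.11
  and its proof, pp. 618–619. [DeJong1997]
* A. J. de Jong, *Smoothness, semi-stability and alterations*, Publ. Math. IHÉS 83 (1996), 3.5,
  4.24–4.28, pp. 64, 75–76. [DeJong1996]
-/

set_option linter.dupNamespace false -- the tree's summit namespace repeats `ResolutionOfSingularities`

noncomputable section

open CategoryTheory CategoryTheory.Limits AlgebraicGeometry TopologicalSpace
open Literature.AlgebraicGeometry.Resolution
open Literature.AlgebraicGeometry
open Scheme.IdealSheafData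

namespace Summit.ResolutionOfSingularities.ResolutionOfSingularities.Theorems

/-! ## `hzero` and the orbit centres for the invariant `QuasiSplitNormalFormPair` -/

/-- **Obligation `hzero` over a perfect field** (de Jong 1996, 4.28: "we finally get the situation
that `X` is nonsingular and `Z` is a normal crossings divisor"): a `QuasiSplitNormalFormPair` over a
perfect field without singular components has `X` regular — every point lies in an irreducible
component of the singular locus if it is singular — and `Z` a normal crossings divisor — by the
formal/étale comparison `isNormalCrossingsDivisor_of_isSNCIdeal_completedStalkIdeal` fed with
field 4.25 (i) of the structure at the closed points of `Z`, all regular.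
[cite: DeJong1996, 4.28, p. 76] [cite: DeJong1997, proof of Prop. 5.11, p. 619] -/
theorem quasiSplitNormalFormPair_hzero {k : Type} [Field k] [PerfectField k] {X : Scheme.{0}}
    {p : X ⟶ Spec (.of k)} {Z : Set X} {G : Type} [Group G] {ρ : G →* Aut X} {d : ℕ}
    (h : DeJong1997.QuasiSplitNormalFormPair p Z ρ d)
    (h0 : irreducibleComponents
      ↥({x : X | ¬ IsRegularLocalRing (X.presheaf.stalk x)} : Set X) = ∅) :
    Scheme.IsRegular X ∧ IsNormalCrossingsDivisor X Z := by
  have hreg := h.isRegular_of_irreducibleComponents_eq_empty h0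
  haveI := h.locallyOfFiniteType
  exact ⟨hreg, isNormalCrossingsDivisor_of_isSNCIdeal_completedStalkIdeal k X p Z h.isClosed
    (fun x _ _ => hreg x) h.isSNCIdeal_completedStalkIdeal⟩

/-- **The orbit centre of `hstep`**: for a `QuasiSplitNormalFormPair` and a subset `E` of the
singular locus (a component, in the iteration), the reduced ideal sheaf of the closure of the orbit
`⋃_g ρ(g)(E)` is non-zero (the orbit closure is a proper closed subset of the variety `X`) and
`ρ`-stable (so the action lifts to the blow-up, `IsBlowup.liftAction`).
[cite: DeJong1997, proof of Prop. 5.11, p. 619] -/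
theorem quasiSplitNormalFormPair_orbitCentre {k : Type} [Field k] {X : Scheme.{0}}
    {p : X ⟶ Spec (.of k)} {Z : Set X} {G : Type} [Group G] {ρ : G →* Aut X} {d : ℕ}
    (h : DeJong1997.QuasiSplitNormalFormPair p Z ρ d)
    (E : Set ↥({x : X | ¬ IsRegularLocalRing (X.presheaf.stalk x)} : Set X)) :
    vanishingIdeal ⟨closure (⋃ g : G, (ρ g).hom.base '' (Subtype.val '' E)), isClosed_closure⟩ ≠ ⊥ ∧
      ∀ g : G, (vanishingIdeal
          ⟨closure (⋃ g : G, (ρ g).hom.base '' (Subtype.val '' E)), isClosed_closure⟩).comap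
            (ρ g).hom =
        vanishingIdeal ⟨closure (⋃ g : G, (ρ g).hom.base '' (Subtype.val '' E)), isClosed_closure⟩ :=
  ⟨h.vanishingIdeal_orbit_ne_bot E, fun g =>
    vanishingIdeal_comap_eq_of_action ρ _ (fun g' => h.preimage_closure_orbit _ g') g⟩

/-! ## The iteration for the invariant `QuasiSplitNormalFormPair`, given (S) -/

/-- **De Jong 1997, Prop. 5.11 ¶3 for a pair already in normal form, given the orbit version of
Claim 4.27** ("Thus we blow up in orbits of components of the singular locus of `X`. The resulting
scheme has a local description as above by the computations of [1, 4.27]. Hence we arrive at a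
regular scheme `X'` with an action of `G` and a `G`-stable normal crossings divisor"): over a
PERFECT field, if (S) every equivariant projective blow-up of a `QuasiSplitNormalFormPair` in the
reduced orbit closure of a component of its singular locus is again a `QuasiSplitNormalFormPair`
(same dimension, lifted action, preimage boundary) with fewer singular components, then for every
`G`-scheme `f ≫ q : X ⟶ Spec k` whose pair `(X, ⋃ᵢ τᵢ(Y) ∪ f⁻¹ D)` with the action `ρX` is a
`QuasiSplitNormalFormPair`, the conclusion of stub B holds verbatim: a `G`-equivariant projective
modification `ψ : X' ⟶ X` with `X'` integral and regular and `ψ⁻¹(⋃ᵢ τᵢ(Y) ∪ f⁻¹ D)` a normal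
crossings divisor. Proof: the landed iteration `ssOrbitBlowup_of_invariant` with
`P X p ρ Z n := QuasiSplitNormalFormPair p Z ρ d ∧ #components(Sing X) = n`; `hint`, `hproj` are
fields of the structure, `hzero` is `quasiSplitNormalFormPair_hzero` (this is where perfectness
enters), `hstep` blows up the orbit closure of any singular component
(`quasiSplitNormalFormPair_orbitCentre`) and invokes (S).
[cite: DeJong1997, proof of Prop. 5.11, p. 619] [cite: DeJong1996, 4.26–4.28, pp. 75–76] -/
theorem ssOrbitBlowup_of_quasiSplitNormalFormPair
    (hS : ∀ (k : Type) [Field k] [PerfectField k] (G : Type) [Group G] [Finite G] (X : Scheme.{0})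
      (p : X ⟶ Spec (.of k)) (ρ : G →* Aut X) (Z : Set X) (d : ℕ),
      DeJong1997.QuasiSplitNormalFormPair p Z ρ d →
      ∀ E ∈ irreducibleComponents ↥({x : X | ¬ IsRegularLocalRing (X.presheaf.stalk x)} : Set X),
      ∀ (X' : Scheme.{0}) (π : X' ⟶ X) (ρ' : G →* Aut X'),
        IsBlowup π (Scheme.IdealSheafData.vanishingIdeal
          ⟨closure (⋃ g : G, (ρ g).hom.base '' (Subtype.val '' E)), isClosed_closure⟩) →
        (∀ g : G, (ρ' g).hom ≫ π = π ≫ (ρ g).hom) →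
        Motives.IsProjectiveOver (Over.mk (π ≫ p)) →
          DeJong1997.QuasiSplitNormalFormPair (π ≫ p) (π.base ⁻¹' Z) ρ' d ∧
          (irreducibleComponents
              ↥({x : X' | ¬ IsRegularLocalRing (X'.presheaf.stalk x)} : Set X')).ncard <
            (irreducibleComponents
              ↥({x : X | ¬ IsRegularLocalRing (X.presheaf.stalk x)} : Set X)).ncard)
    (k : Type) [Field k] [PerfectField k] (X Y : Scheme.{0}) (f : X ⟶ Y) (q : Y ⟶ Spec (.of k))
    (D : Set Y) (m : ℕ) (τ : Fin m → (Y ⟶ X)) (G : Type) [Group G] [Finite G] (ρX : G →* Aut X)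
    (d : ℕ) (h : DeJong1997.QuasiSplitNormalFormPair (f ≫ q) (DeJong1996.semiStableBoundary f D τ) ρX d) :
    ∃ (X' : Scheme.{0}) (_ : IsIntegral X') (ψ : X' ⟶ X) (ρX' : G →* Aut X'),
      IsModification ψ ∧ (∀ g : G, (ρX' g).hom ≫ ψ = ψ ≫ (ρX g).hom) ∧
        Motives.IsProjectiveOver (Over.mk ((ψ ≫ f) ≫ q)) ∧ Scheme.IsRegular X' ∧
          IsNormalCrossingsDivisor X' (ψ.base ⁻¹' DeJong1996.semiStableBoundary f D τ) := by
  -- the invariant: normal form of dimension `d` with `n` singular components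
  let P : ∀ (X : Scheme.{0}), (X ⟶ Spec (.of k)) → (G →* Aut X) → Set X → ℕ → Prop :=
    fun X p ρ Z n => DeJong1997.QuasiSplitNormalFormPair p Z ρ d ∧
      (irreducibleComponents
        ↥({x : X | ¬ IsRegularLocalRing (X.presheaf.stalk x)} : Set X)).ncard = n
  have h0 : P X (f ≫ q) ρX (DeJong1996.semiStableBoundary f D τ) _ := ⟨h, rfl⟩
  refine ssOrbitBlowup_of_invariant f q D τ ρX P (fun X p ρ Z n h => h.1.isIntegral)
    (fun X p ρ Z n h => h.1.isProjectiveOver) (fun X p ρ Z h => ?_) (fun X p ρ Z n h => ?_) h0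
  · -- `hzero`
    exact quasiSplitNormalFormPair_hzero h.1
      ((Set.ncard_eq_zero h.1.finite_irreducibleComponents).mp h.2)
  · -- `hstep`: blow up the orbit closure of a singular component and invoke (S)
    obtain ⟨hQ, hn⟩ := h
    obtain ⟨E, hE⟩ : (irreducibleComponents
        ↥({x : X | ¬ IsRegularLocalRing (X.presheaf.stalk x)} : Set X)).Nonempty := by
      rw [Set.nonempty_iff_ne_empty]
      intro he
      rw [he, Set.ncard_empty] at hn
      exact Nat.succ_ne_zero n hn.symm
    obtain ⟨hne, hstab⟩ := quasiSplitNormalFormPair_orbitCentre hQ E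
    refine ⟨_, hne, hstab, fun X' π ρ' hπ hequiv hproj' => ?_⟩
    obtain ⟨hQ', hlt⟩ := hS k G X p ρ Z d hQ E hE X' π ρ' hπ hequiv hproj'
    rw [hn] at hlt
    exact ⟨_, Nat.lt_succ_iff.mp hlt, hQ', rfl⟩

/-! ## Stub B over a perfect field from (N) and (S) -/

/-- **Stub B (`stub_pair_ssOrbitBlowup`) over a PERFECT field, from its two next-layer statements**
(de Jong 1997, Prop. 5.11 ¶2–3 = de Jong 1996, 3.5 + 4.25–4.28 equivariant): given
(N) the entry — every quasi-split `G`-semi-stable pair of the line with `codim(Sing X, X) ≥ 3`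
over a perfect field is, with its boundary `⋃ᵢ τᵢ(Y) ∪ f⁻¹ D` and action `ρX`, a
`DeJong1997.QuasiSplitNormalFormPair` of some dimension `d` (3.5 for quasi-split curves, the
boundary as a divisor, formal normal crossings off `Sing X`, orbits of singular components
regular by `G`-strictness of `D`) — and (S) the orbit version of Claim 4.27 — an equivariant
projective blow-up of a `QuasiSplitNormalFormPair` over a perfect field in the reduced orbit
closure of a component of `Sing X` is a `QuasiSplitNormalFormPair` of the same dimension for the
lifted action and the preimage boundary, with fewer singular components — the conclusion of
stub B holds VERBATIM for every datum of stub B over a perfect field: a `G`-equivariant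
projective modification `ψ : X' ⟶ X` with `X'` integral and regular and
`ψ⁻¹(⋃ᵢ τᵢ(Y) ∪ f⁻¹ D)` a normal crossings divisor. Proof: the landed iteration
`ssOrbitBlowup_of_invariant` with the invariant
`P X p ρ Z n := QuasiSplitNormalFormPair p Z ρ d ∧ #components(Sing X) = n`; `hint`, `hproj`
are fields of the structure, `hzero` is `quasiSplitNormalFormPair_hzero`, `hstep` blows up the
orbit closure of any singular component (`quasiSplitNormalFormPair_orbitCentre`) and invokes (S).
[cite: DeJong1997, proof of Prop. 5.11, p. 619] [cite: DeJong1996, 4.25–4.28, pp. 75–76] -/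
theorem stub_pair_ssOrbitBlowup_of_normalForm_of_orbitClaim
    (hN : ∀ (k : Type) [Field k] [PerfectField k] (X Y : Scheme.{0}) [IsIntegral X] [IsIntegral Y]
      (f : X ⟶ Y) (q : Y ⟶ Spec (.of k)),
      Motives.IsProjectiveOver (Over.mk (f ≫ q)) → Motives.IsProjectiveOver (Over.mk q) →
      Scheme.IsRegular Y → ∀ (D : Set Y) (hD : IsStrictNormalCrossingsDivisor Y D)
      (G : Type) [Group G] [Finite G] (ρX : G →* Aut X) (ρY : G →* Aut Y),
      (∀ g : G, (ρX g).hom ≫ f = f ≫ (ρY g).hom) →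
      (∀ g : G, (ρY g).hom.base '' D = D) →
      (∀ (g : G) (C : Set Y), Maximal (fun C : Set Y => IsIrreducible C ∧ C ⊆ D) C →
        (C ∩ (ρY g).hom.base '' C).Nonempty → (ρY g).hom.base '' C = C) →
      IsSemiStableCurve f →
      (∀ x : X, (¬ ∃ U : X.Opens, x ∈ U ∧ Smooth (U.ι ≫ f)) →
        ∃ e : AdicCompletion
            ((IsLocalRing.maximalIdeal (X.presheaf.stalk x)).map (Ideal.Quotient.mk
              ((IsLocalRing.maximalIdeal (Y.presheaf.stalk (f.base x))).map (f.stalkMap x).hom)))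
            (X.presheaf.stalk x ⧸
              (IsLocalRing.maximalIdeal (Y.presheaf.stalk (f.base x))).map (f.stalkMap x).hom) ≃+*
          MvPowerSeries (Fin 2) (Y.presheaf.stalk (f.base x) ⧸
              IsLocalRing.maximalIdeal (Y.presheaf.stalk (f.base x))) ⧸
            Ideal.span {(MvPowerSeries.X 0 * MvPowerSeries.X 1 :
              MvPowerSeries (Fin 2) (Y.presheaf.stalk (f.base x) ⧸
                IsLocalRing.maximalIdeal (Y.presheaf.stalk (f.base x))))},
          e.toRingHom.comp ((algebraMap (X.presheaf.stalk x ⧸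
              (IsLocalRing.maximalIdeal (Y.presheaf.stalk (f.base x))).map (f.stalkMap x).hom) _).comp
            (Ideal.quotientMap ((IsLocalRing.maximalIdeal (Y.presheaf.stalk (f.base x))).map
              (f.stalkMap x).hom) (f.stalkMap x).hom Ideal.le_comap_map)) =
          algebraMap (Y.presheaf.stalk (f.base x) ⧸
            IsLocalRing.maximalIdeal (Y.presheaf.stalk (f.base x))) _) →
      Smooth (f ∣_ ⟨Dᶜ, hD.isClosed.isOpen_compl⟩) →
      ∀ (m : ℕ) (τ : Fin m → (Y ⟶ X)), (∀ i : Fin m, τ i ≫ f = 𝟙 Y) →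
      (Pairwise fun i j : Fin m => Disjoint (Set.range (τ i)) (Set.range (τ j))) →
      (∀ i : Fin m, ∃ U : X.Opens, Set.range (τ i) ⊆ (U : Set X) ∧ Smooth (U.ι ≫ f)) →
      (∀ (g : G) (i : Fin m), ∃ j : Fin m, τ i ≫ (ρX g).hom = (ρY g).hom ≫ τ j) →
      (∀ x : X, ¬ IsRegularLocalRing (X.presheaf.stalk x) →
        (3 : WithBot ℕ∞) ≤ ringKrullDim (X.presheaf.stalk x)) →
      ∃ d : ℕ, DeJong1997.QuasiSplitNormalFormPair (f ≫ q) (DeJong1996.semiStableBoundary f D τ) ρX d)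
    (hS : ∀ (k : Type) [Field k] [PerfectField k] (G : Type) [Group G] [Finite G] (X : Scheme.{0})
      (p : X ⟶ Spec (.of k)) (ρ : G →* Aut X) (Z : Set X) (d : ℕ),
      DeJong1997.QuasiSplitNormalFormPair p Z ρ d →
      ∀ E ∈ irreducibleComponents ↥({x : X | ¬ IsRegularLocalRing (X.presheaf.stalk x)} : Set X),
      ∀ (X' : Scheme.{0}) (π : X' ⟶ X) (ρ' : G →* Aut X'),
        IsBlowup π (Scheme.IdealSheafData.vanishingIdeal
          ⟨closure (⋃ g : G, (ρ g).hom.base '' (Subtype.val '' E)), isClosed_closure⟩) →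
        (∀ g : G, (ρ' g).hom ≫ π = π ≫ (ρ g).hom) →
        Motives.IsProjectiveOver (Over.mk (π ≫ p)) →
          DeJong1997.QuasiSplitNormalFormPair (π ≫ p) (π.base ⁻¹' Z) ρ' d ∧
          (irreducibleComponents
              ↥({x : X' | ¬ IsRegularLocalRing (X'.presheaf.stalk x)} : Set X')).ncard <
            (irreducibleComponents
              ↥({x : X | ¬ IsRegularLocalRing (X.presheaf.stalk x)} : Set X)).ncard)
    (k : Type) [Field k] [PerfectField k] (X Y : Scheme.{0}) [IsIntegral X] [IsIntegral Y]
    (f : X ⟶ Y) (q : Y ⟶ Spec (.of k))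
    (hprojX : Motives.IsProjectiveOver (Over.mk (f ≫ q))) (hprojY : Motives.IsProjectiveOver (Over.mk q))
    (hreg : Scheme.IsRegular Y)
    (D : Set Y) (hD : IsStrictNormalCrossingsDivisor Y D)
    (G : Type) [Group G] [Finite G] (ρX : G →* Aut X) (ρY : G →* Aut Y)
    (hρf : (∀ g : G, (ρX g).hom ≫ f = f ≫ (ρY g).hom))
    (hDG : (∀ g : G, (ρY g).hom.base '' D = D))
    (hDstrict : (∀ (g : G) (C : Set Y), Maximal (fun C : Set Y => IsIrreducible C ∧ C ⊆ D) C →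
        (C ∩ (ρY g).hom.base '' C).Nonempty → (ρY g).hom.base '' C = C))
    (hss : IsSemiStableCurve f)
    (hqs : (∀ x : X, (¬ ∃ U : X.Opens, x ∈ U ∧ Smooth (U.ι ≫ f)) →
        ∃ e : AdicCompletion
            ((IsLocalRing.maximalIdeal (X.presheaf.stalk x)).map (Ideal.Quotient.mk
              ((IsLocalRing.maximalIdeal (Y.presheaf.stalk (f.base x))).map (f.stalkMap x).hom)))
            (X.presheaf.stalk x ⧸
              (IsLocalRing.maximalIdeal (Y.presheaf.stalk (f.base x))).map (f.stalkMap x).hom) ≃+*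
          MvPowerSeries (Fin 2) (Y.presheaf.stalk (f.base x) ⧸ IsLocalRing.maximalIdeal (Y.presheaf.stalk (f.base x))) ⧸
            Ideal.span {(MvPowerSeries.X 0 * MvPowerSeries.X 1 :
              MvPowerSeries (Fin 2) (Y.presheaf.stalk (f.base x) ⧸ IsLocalRing.maximalIdeal (Y.presheaf.stalk (f.base x))))},
          e.toRingHom.comp ((algebraMap (X.presheaf.stalk x ⧸
              (IsLocalRing.maximalIdeal (Y.presheaf.stalk (f.base x))).map (f.stalkMap x).hom) _).comp
            (Ideal.quotientMap ((IsLocalRing.maximalIdeal (Y.presheaf.stalk (f.base x))).map (f.stalkMap x).hom)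
              (f.stalkMap x).hom Ideal.le_comap_map)) =
          algebraMap (Y.presheaf.stalk (f.base x) ⧸ IsLocalRing.maximalIdeal (Y.presheaf.stalk (f.base x))) _))
    (hsm : Smooth (f ∣_ ⟨Dᶜ, hD.isClosed.isOpen_compl⟩))
    (m : ℕ) (τ : Fin m → (Y ⟶ X)) (hτf : (∀ i : Fin m, τ i ≫ f = 𝟙 Y))
    (hτdisj : (Pairwise fun i j : Fin m => Disjoint (Set.range (τ i)) (Set.range (τ j))))
    (hτsm : (∀ i : Fin m, ∃ U : X.Opens, Set.range (τ i) ⊆ (U : Set X) ∧ Smooth (U.ι ≫ f)))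
    (hτG : (∀ (g : G) (i : Fin m), ∃ j : Fin m, τ i ≫ (ρX g).hom = (ρY g).hom ≫ τ j))
    (hcodim : (∀ x : X, ¬ IsRegularLocalRing (X.presheaf.stalk x) →
            (3 : WithBot ℕ∞) ≤ ringKrullDim (X.presheaf.stalk x))) :
    ∃ (X' : Scheme.{0}) (_ : IsIntegral X') (ψ : X' ⟶ X) (ρX' : G →* Aut X'),
          IsModification ψ ∧ (∀ g : G, (ρX' g).hom ≫ ψ = ψ ≫ (ρX g).hom) ∧
          Motives.IsProjectiveOver (Over.mk ((ψ ≫ f) ≫ q)) ∧ Scheme.IsRegular X' ∧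
          IsNormalCrossingsDivisor X' (ψ.base ⁻¹' DeJong1996.semiStableBoundary f D τ) := by
  -- (N): the datum is a `QuasiSplitNormalFormPair` of some dimension `d`; then iterate with (S)
  obtain ⟨d, hP⟩ := hN k X Y f q hprojX hprojY hreg D hD G ρX ρY hρf hDG hDstrict hss hqs hsm m τ
    hτf hτdisj hτsm hτG hcodim
  exact ssOrbitBlowup_of_quasiSplitNormalFormPair hS k X Y f q D m τ G ρX d hP

end Summit.ResolutionOfSingularities.ResolutionOfSingularities.Theorems

end
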